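/-
¬hJ RUSH — N273 BRIDGE (hmusep-p5 g3, 2026-08-24), desk file, NOT A FILING.  HC_CM is NOT proved; nothing here asserts hJ, hJ₀, ¬hJ₀ or (P-K).
From the PRINT-SHAPED row N272 «for a smooth projective `X/ℂ`, complex conjugation of points `X(ℂ) → X^σ(ℂ)` (σ = conj) exchanges
`H^{p,q}(X)` and `H^{q,p}(X^σ)`» (stated over ✔ `Motives.conjugateVariety` ∕ ✔ `AlgPoints.conjugateHomeomorph`) to mukey-p10's
two-embedding interface of record `BettiConjSwapsHodgePieces hHD` (over ✔ wb-1 `bettiConjLinearEquiv`), which is what M3 consumes.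
Ingredients, all ✔ tree: the base-change transitivity iso `(Y ×_ι ℂ)^σ ≅ Y ×_ῑ ℂ` (`Motives.baseChangeHomObjIsoOfComp`), the point
formulas `toSpecHom_toConjugate_comp_conjFst` ∕ `twist_left` ∕ `baseChangeEquiv_symm_apply_left`, and `BettiUniverse.pull_hodge`.
-/
import Summits.HodgeConjecture.CorCM.D2Bridge.BettiConjugateEmbedding
import Literature.AlgebraicGeometry.Motives.ConjugatePointsHomeomorph
import Literature.AlgebraicGeometry.Motives.FiberBaseChange
import Literature.AlgebraicGeometry.Motives.BaseChangeProofs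
import Literature.AlgebraicGeometry.Motives.HodgeStructureWeil
import Literature.AlgebraicGeometry.HodgeTheory.FrobeniusInfinityAntiHodge
import HarnessLib

/-!
# (P-K) bridge: from the conjugate-variety row to the two-embedding clauses (N273)

From the ✔ Literature row `Literature.AlgebraicGeometry.HodgeTheory.ConjugateVarietySwapsHodgePieces` ([Deligne 1979, §0.2.5]: complex
conjugation of points `X(ℂ) ≃ X^σ(ℂ)` exchanges `H^{p,q}` and `H^{q,p}`) to the clauses HEAD-B consumes: for `Y/L` smooth projective and
`ι : L →+* ℂ`, wb-1's `bettiConjLinearEquiv ι Y k` maps `H^{p,q}(Y ×_ι ℂ)` into `H^{q,p}(Y ×_ῑ ℂ)` and its inverse maps back.  Ingredients: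
the transitivity isomorphism `(Y ×_ι ℂ)^σ ≅ Y ×_ῑ ℂ` (`Motives.baseChangeHomObjIsoOfComp`), the identification of wb-1's conjugation of points
with Charles–Schnell's `toConjugate`, and Hodge functoriality of pull-backs (`BettiUniverse.pullHodgeHom`).  HC_CM is NOT proved; (P-K) is a
HYPOTHESIS of the theorem.
-/

set_option autoImplicit false

noncomputable section

open CategoryTheory CategoryTheory.Limits AlgebraicGeometry Topology
open Literature.AlgebraicGeometry.Motives Literature.AlgebraicGeometry.HodgeTheory
open Literature.AlgebraicTopology.SingularHomology
open scoped TensorProduct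

namespace Summit.HodgeConjecture.CorCM.D2Bridge

/-! (P-K) is the ✔ Literature row `Literature.AlgebraicGeometry.HodgeTheory.ConjugateVarietySwapsHodgePieces` (N272, p382103);
the two-embedding clauses below are mukey-p10's interface `BettiConjSwapsHodgePieces`, stated inline (no `def`). -/

/-! ## §1 Geometry: `(Y ×_ι ℂ)^σ ≅ Y ×_ῑ ℂ` over `Spec ℂ`, and wb-1's conjugation of points factors through `toConjugate` -/

section Geometry

variable {L : Type} [Field L] (ι : L →+* ℂ) (Y : SchemeOver L)

/-- The transitivity isomorphism `(Y ×_{L,ι} ℂ)^σ = (Y ×_ι ℂ) ×_{ℂ,conj} ℂ ≅ Y ×_{L,ῑ} ℂ` over `Spec ℂ` (✔ `Motives.baseChangeHomObjIsoOfComp`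
at `conj ∘ ι = ῑ`). [cite: GortzWedhorn2020, Prop. 4.16] -/
def conjugateBaseChangeIso :
    conjugateVariety starRingAut ((baseChangeHom ι).obj Y) ≅ (baseChangeHom (conjEmb ι)).obj Y :=
  baseChangeHomObjIsoOfComp ι (starRingAut : ℂ ≃+* ℂ).toRingHom (conjEmb ι) (conjEmb_eq ι).symm Y

/-- The transitivity isomorphism commutes with the projections to `Y`:
`e ≫ π_ῑ = π_σ ≫ π_ι` on underlying schemes. [cite: GortzWedhorn2020, Prop. 4.16] -/
theorem conjugateBaseChangeIso_hom_left_fst :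
    (conjugateBaseChangeIso ι Y).hom.left ≫ baseChangeHomFst (conjEmb ι) Y =
      AlgPoints.conjFst starRingAut ((baseChangeHom ι).obj Y) ≫ baseChangeHomFst ι Y :=
  baseChangeHomObjIsoOfComp_hom_left_fst ι (starRingAut : ℂ ≃+* ℂ).toRingHom (conjEmb ι) (conjEmb_eq ι).symm Y

/-- **wb-1's conjugation of points IS Charles–Schnell's `toConjugate` followed by the transitivity isomorphism**:
`conjComplexPoints ι Y Q = toConjugate Q ≫ e`.  Both are the point `Spec conj ≫ Q ≫ π_ι` of `Y` re-packaged over `Spec ℂ`.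
[cite: CharlesSchnell2014Notes, §11.2.2 (11.2.1)] -/
theorem conjComplexPoints_eq_map_toConjugate (Q : ComplexPoints ((baseChangeHom ι).obj Y)) :
    conjComplexPoints ι Y Q =
      AlgPoints.map (conjugateBaseChangeIso ι Y).hom (AlgPoints.toConjugate starRingAut ((baseChangeHom ι).obj Y) Q) := by
  letI := (conjEmb ι).toAlgebra
  -- two complex points of `Y ×_ῑ ℂ` agree as soon as the `L`-points `Spec ℂ → Y` under them agree
  apply (AlgPoints.baseChangeEquiv (conjEmb ι) Y).symm.injective
  ext : 1
  rw [AlgPoints.baseChangeEquiv_symm_apply_left, AlgPoints.baseChangeEquiv_symm_apply_left]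
  -- the left-hand side: `Spec conj ≫ Q ≫ π_ι`
  have hL : (conjComplexPoints ι Y Q).left ≫ baseChangeHomFst (conjEmb ι) Y =
      Spec.map (CommRingCat.ofHom (starRingAut : ℂ ≃+* ℂ).toRingHom) ≫ Q.left ≫ baseChangeHomFst ι Y := by
    letI := ι.toAlgebra
    change (conjPoints ι (conjEmb ι) starRingAut (conjEmb_eq ι) continuous_starRingAut continuous_starRingAut_symm Y Q).left ≫ _ = _
    rw [conjPoints_apply, AlgPoints.baseChangeEquiv_apply_left_comp_fst, twist_left,
      AlgPoints.baseChangeEquiv_symm_apply_left]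
    rfl
  -- the right-hand side: `toConjugate Q ≫ e ≫ π_ῑ = toConjugate Q ≫ π_σ ≫ π_ι = Spec conj ≫ Q ≫ π_ι`
  have hR : (AlgPoints.map (conjugateBaseChangeIso ι Y).hom
        (AlgPoints.toConjugate starRingAut ((baseChangeHom ι).obj Y) Q)).left ≫ baseChangeHomFst (conjEmb ι) Y =
      Spec.map (CommRingCat.ofHom (starRingAut : ℂ ≃+* ℂ).toRingHom) ≫ Q.left ≫ baseChangeHomFst ι Y := by
    have h3 := AlgPoints.toSpecHom_toConjugate_comp_conjFst (σ := starRingAut) (Y := (baseChangeHom ι).obj Y) Q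
    rw [AlgPoints.map_apply, Over.comp_left, Category.assoc, conjugateBaseChangeIso_hom_left_fst, ← Category.assoc]
    exact (congrArg (· ≫ baseChangeHomFst ι Y) h3).trans (Category.assoc _ _ _)
  rw [hL, hR]

/-- The inverse direction: `(conjComplexPoints ι Y)⁻¹ = ofConjugate ∘ (points of e⁻¹)`. [cite: CharlesSchnell2014Notes, §11.2.2 (11.2.1)] -/
theorem conjComplexPoints_symm_eq (Q' : ComplexPoints ((baseChangeHom (conjEmb ι)).obj Y)) :
    (conjComplexPoints ι Y).symm Q' =
      (AlgPoints.conjugateHomeomorph starRingAut ((baseChangeHom ι).obj Y) continuous_starRingAut).symm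
        (AlgPoints.map (conjugateBaseChangeIso ι Y).inv Q') := by
  rw [Homeomorph.symm_apply_eq, conjComplexPoints_eq_map_toConjugate, AlgPoints.conjugateHomeomorph_symm_apply,
    AlgPoints.toConjugate_ofConjugate, ← AlgPoints.map_comp_apply, Iso.inv_hom_id, AlgPoints.map_id_apply]

end Geometry

/-! ## §2 Cohomology: `κ = (e⁻¹)^* ∘ (σ-points iso)` on `Hᵏ(−; ℚ)` -/

section Cohomology

variable {L : Type} [Field L] (ι : L →+* ℂ) (Y : SchemeOver L) (k : ℕ)

/-- **wb-1's `κ` factors**: `bettiConjLinearEquiv ι Y k = (e⁻¹)^* ∘ (pull-back along the inverse σ-points homeomorphism)`, as `ℚ`-linear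
maps `Hᵏ((Y ×_ι ℂ)(ℂ); ℚ) → Hᵏ((Y ×_ῑ ℂ)(ℂ); ℚ)`. [cite: CharlesSchnell2014Notes, §11.2.2 (11.2.1)] -/
theorem bettiConjLinearEquiv_eq_pull_comp :
    (bettiConjLinearEquiv ι Y k).toLinearMap =
      BettiUniverse.pull (conjugateBaseChangeIso ι Y).inv k ∘ₗ
        (singularCohomology.mapIso ℚ ℚ
          (AlgPoints.conjugateHomeomorph starRingAut ((baseChangeHom ι).obj Y) continuous_starRingAut).symm k).toLinearEquiv.toLinearMap := by
  -- the continuous maps agree: `c⁻¹ = t⁻¹ ∘ e⁻¹(ℂ)`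
  have hmaps : (⟨(conjComplexPoints ι Y).symm, (conjComplexPoints ι Y).symm.continuous⟩ :
        C(ComplexPoints ((baseChangeHom (conjEmb ι)).obj Y), ComplexPoints ((baseChangeHom ι).obj Y))) =
      (⟨(AlgPoints.conjugateHomeomorph starRingAut ((baseChangeHom ι).obj Y) continuous_starRingAut).symm,
          (AlgPoints.conjugateHomeomorph starRingAut ((baseChangeHom ι).obj Y) continuous_starRingAut).symm.continuous⟩ :
          C(_, _)).comp (AlgPoints.mapContinuous (L := ℂ) (conjugateBaseChangeIso ι Y).inv) := by
    ext Q' : 1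
    exact conjComplexPoints_symm_eq ι Y Q'
  have hmap : (bettiConjIso ι Y k).hom =
      singularCohomology.map ℚ ℚ
          (⟨(AlgPoints.conjugateHomeomorph starRingAut ((baseChangeHom ι).obj Y) continuous_starRingAut).symm,
            (AlgPoints.conjugateHomeomorph starRingAut ((baseChangeHom ι).obj Y) continuous_starRingAut).symm.continuous⟩ : C(_, _)) k ≫
        bettiCohomology.map (conjugateBaseChangeIso ι Y).inv k := by
    change singularCohomology.map ℚ ℚ _ k = _
    rw [← singularCohomology.map_comp, ← hmaps]
  apply LinearMap.ext
  intro x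
  change (bettiConjIso ι Y k).hom.hom x =
    (bettiCohomology.map (conjugateBaseChangeIso ι Y).inv k).hom
      ((singularCohomology.map ℚ ℚ
        (⟨(AlgPoints.conjugateHomeomorph starRingAut ((baseChangeHom ι).obj Y) continuous_starRingAut).symm,
          (AlgPoints.conjugateHomeomorph starRingAut ((baseChangeHom ι).obj Y) continuous_starRingAut).symm.continuous⟩ : C(_, _)) k).hom x)
  rw [hmap]
  rfl

end Cohomology

/-! ## §3 The bridge: N272 (print shape) ⇒ `BettiConjSwapsHodgePieces` (two-embedding shape) -/

section Bridge

variable {L : Type} [Field L] (ι : L →+* ℂ) {n : ℕ} (Y : SchemeOver L) (hY : IsSmoothProjective n Y) (k : ℕ)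

/-- `(e⁻¹)^* ∘ e^* = id` on `Hᵏ` for the transitivity isomorphism `e`. [folklore] -/
theorem pull_inv_comp_pull_hom :
    BettiUniverse.pull (conjugateBaseChangeIso ι Y).inv k ∘ₗ BettiUniverse.pull (conjugateBaseChangeIso ι Y).hom k = LinearMap.id := by
  rw [← BettiUniverse.pull_comp, Iso.inv_hom_id, BettiUniverse.pull_id]

/-- `e^* ∘ (e⁻¹)^* = id` on `Hᵏ`. [folklore] -/
theorem pull_hom_comp_pull_inv :
    BettiUniverse.pull (conjugateBaseChangeIso ι Y).hom k ∘ₗ BettiUniverse.pull (conjugateBaseChangeIso ι Y).inv k = LinearMap.id := by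
  rw [← BettiUniverse.pull_comp, Iso.hom_inv_id, BettiUniverse.pull_id]

/-- **THE BRIDGE.**  The print-shaped row (P-K) over conjugate varieties implies mukey-p10's two-embedding statement over wb-1's
`bettiConjLinearEquiv` (granted `hI`, model-independence of the pieces, for Hodge functoriality of the pull-back along the `ℂ`-ISOMORPHISM
`(Y ×_ι ℂ)^σ ≅ Y ×_ῑ ℂ`). [cite: DeligneEtAl1982, I §1] [cite: VoisinHodgeI2002, §7.3.2] -/
theorem bettiConjSwapsHodgePieces_of_conjugateVariety (hHD : exists_isReal_hodgeModel) (hI : hodgePQ_independent_of_hodgeModel)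
    (hPK : Literature.AlgebraicGeometry.HodgeTheory.ConjugateVarietySwapsHodgePieces hHD)
    {L : Type} [Field L] (ι : L →+* ℂ) {n : ℕ} (Y : SchemeOver L) (hY : IsSmoothProjective n Y) (k : ℕ) (p q : ℤ) :
    (∀ x : TensorProduct ℚ ℂ (bettiCohomology ((baseChangeHom ι).obj Y) k),
      x ∈ (BettiUniverse.hodge hHD (IsSmoothProjective.baseChangeHom_holds ι hY) k).piece p q →
        (bettiConjLinearEquiv ι Y k).toLinearMap.baseChange ℂ x ∈
          (BettiUniverse.hodge hHD (IsSmoothProjective.baseChangeHom_holds (conjEmb ι) hY) k).piece q p) ∧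
    (∀ x' : TensorProduct ℚ ℂ (bettiCohomology ((baseChangeHom (conjEmb ι)).obj Y) k),
      x' ∈ (BettiUniverse.hodge hHD (IsSmoothProjective.baseChangeHom_holds (conjEmb ι) hY) k).piece p q →
        (bettiConjLinearEquiv ι Y k).symm.toLinearMap.baseChange ℂ x' ∈
          (BettiUniverse.hodge hHD (IsSmoothProjective.baseChangeHom_holds ι hY) k).piece q p) := by
  -- abbreviations
  have hXι : IsSmoothProjective n ((baseChangeHom ι).obj Y) := IsSmoothProjective.baseChangeHom_holds ι hY
  let e := conjugateBaseChangeIso ι Y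
  let tQ : bettiCohomology ((baseChangeHom ι).obj Y) k ≃ₗ[ℚ]
      bettiCohomology (conjugateVariety starRingAut ((baseChangeHom ι).obj Y)) k :=
    (singularCohomology.mapIso ℚ ℚ
      (AlgPoints.conjugateHomeomorph starRingAut ((baseChangeHom ι).obj Y) continuous_starRingAut).symm k).toLinearEquiv
  -- the Hodge morphisms along the `ℂ`-isomorphism `e`
  let Einv := BettiUniverse.pullHodgeHom hHD hI (IsSmoothProjective.baseChangeHom_holds (conjEmb ι) hY)
    (IsSmoothProjective.conjugateVariety_holds starRingAut hXι) e.inv k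
  let Ehom := BettiUniverse.pullHodgeHom hHD hI (IsSmoothProjective.conjugateVariety_holds starRingAut hXι)
    (IsSmoothProjective.baseChangeHom_holds (conjEmb ι) hY) e.hom k
  -- κ = (e⁻¹)^* ∘ t, complexified
  have hκ : (bettiConjLinearEquiv ι Y k).toLinearMap.baseChange ℂ =
      (BettiUniverse.pull e.inv k).baseChange ℂ ∘ₗ tQ.toLinearMap.baseChange ℂ := by
    rw [← LinearMap.baseChange_comp, ← bettiConjLinearEquiv_eq_pull_comp]
  -- the print row at `X := Y ×_ι ℂ`
  have hrow : ∀ p q : ℤ, ((BettiUniverse.hodge hHD hXι k).piece p q).map (tQ.toLinearMap.baseChange ℂ) =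
      (BettiUniverse.hodge hHD (IsSmoothProjective.conjugateVariety_holds starRingAut hXι) k).piece q p :=
    fun p q => hPK ((baseChangeHom ι).obj Y) hXι k p q
  refine ⟨fun x hx => ?_, fun x' hx' => ?_⟩
  · -- forward: t_ℂ x ∈ H^{q,p}((Y ×_ι ℂ)^σ), then (e⁻¹)^* is a morphism of Hodge structures
    rw [hκ, LinearMap.comp_apply]
    have h1 : tQ.toLinearMap.baseChange ℂ x ∈
        (BettiUniverse.hodge hHD (IsSmoothProjective.conjugateVariety_holds starRingAut hXι) k).piece q p := by
      rw [← hrow p q]; exact Submodule.mem_map_of_mem hx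
    exact Einv.map_piece_le q p (Submodule.mem_map_of_mem h1)
  · -- backward: e^* x' ∈ H^{p,q}((Y ×_ι ℂ)^σ) = t_ℂ (H^{q,p}(Y ×_ι ℂ)); the preimage is κ⁻¹ x'
    have h1 : (BettiUniverse.pull e.hom k).baseChange ℂ x' ∈
        (BettiUniverse.hodge hHD (IsSmoothProjective.conjugateVariety_holds starRingAut hXι) k).piece p q :=
      Ehom.map_piece_le p q (Submodule.mem_map_of_mem hx')
    rw [← hrow q p] at h1
    obtain ⟨y, hy, hyx⟩ := h1
    -- `κ_ℂ y = x'`, hence `κ⁻¹_ℂ x' = y`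
    have hκy : (bettiConjLinearEquiv ι Y k).toLinearMap.baseChange ℂ y = x' := by
      rw [hκ, LinearMap.comp_apply, hyx, ← LinearMap.comp_apply, ← LinearMap.baseChange_comp,
        pull_inv_comp_pull_hom, LinearMap.baseChange_id, LinearMap.id_apply]
    have hinv : (bettiConjLinearEquiv ι Y k).symm.toLinearMap.baseChange ℂ x' = y := by
      rw [← hκy, ← LinearMap.comp_apply, ← LinearMap.baseChange_comp]
      have : (bettiConjLinearEquiv ι Y k).symm.toLinearMap ∘ₗ (bettiConjLinearEquiv ι Y k).toLinearMap = LinearMap.id :=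
        LinearMap.ext fun z => (bettiConjLinearEquiv ι Y k).symm_apply_apply z
      rw [this, LinearMap.baseChange_id, LinearMap.id_apply]
    rw [hinv]
    exact hy

end Bridge

end Summit.HodgeConjecture.CorCM.D2Bridge

end
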